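import Summits.ValiantsHypothesis.ValiantsHypothesis.Theorems.LacunarySymmetroidMatrixDescartesSeparatedSector

/-!
# `MatrixDescartes` — the LETTER-SEPARATED SECTOR in RELATIVE currency: other letters `≤ ε ×` the live pair,
# conditioning `|det S l| ≥ η σ_l^m`, and one constant `(m+1)^m·m!·m·3^m·ε < η`

HONEST FRAMING.  Object-search cell `pub-symmetroid`, crux `Theses.LacunarySymmetroid.MatrixDescartes`
(ledger item `stmt-ValiantsHypothesis-18050`, route `LacunarySymmetroid`; seat `val-sym-mdr-p2`, gen 12).  The
crux implies `VP ≠ VNP` by the route's assembly; NOTHING here is progress on it and nothing here is a claim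
about `VP ≠ VNP`, `DoorA26` / `DoorA34` or the cell's registers.  This file restates the letter-separated sector
(`…SeparatedSector.lean`, polynomial inequalities in `x`) in the currency one actually checks on a design:

* a CONDITIONING constant `η`: `|det S l| ≥ η·σ_l^m` for every letter (`σ_l` = entry bound, `σ_l > 0`);
* a SMALLNESS constant `ε ≤ 1` with `(m+1)^m·m!·m·3^m·ε < η`;
* per window `(u, v)` with live pair `a, b` (`d a < d b`): HAND-OVER (`σ_b u^(d b) ≤ ε·σ_a u^(d a)`,
  `σ_a v^(d a) ≤ ε·σ_b v^(d b)`) and SMALLNESS of the other letters (`∑_{l≠a,b} σ_l x^(d l) ≤ ε·max(σ_a x^(d a), σ_b x^(d b))`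
  on `[u, v]`);
* outside the windows, at every `x > 0`, some letter `l₀` with `∑_{l≠l₀} σ_l x^(d l) ≤ ε·σ_{l₀} x^(d l₀)`.

Then: `card_realRoots_window_le_of_relSeparated` (≤ `m` real zeros per window), `not_isRoot_of_relDominance`,
`card_posRoots_le_of_relSeparated` (`Z₊ ≤ N·m`), `card_realRoots_le_of_relSeparated` (`Z ≤ 2Nm + 1`, the reflected
pencil carries the same certificate) and `relSeparatedSector_mdr` (the crux's inequality on the sector at all fat
formats, `N ≤ K`).  The arithmetic (`rel_arith_win`, `rel_arith_end`) is `E ≤ εT`, `M ≤ 2T` ⇒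
`(m+1)^m·m!·m·E·(M+E)^(m−1) ≤ (m+1)^m·m!·m·3^m·ε·T^m < η·T^m ≤ |det|·x^(m d)`.  The price of separation is thus
explicit: `ε < η / ((m+1)^m·m!·m·3^m) = exp(−O(m log m))·η` — a valuation margin of order `m log m + log(1/η)`
per hand-over, the matrix-level ambiguity width of `HOME/…/GAP-LIFT.md` §3 (M2).  Sector bookkeeping beside the
crux; the cell's extremal rows are far outside it. [folklore]
-/


-- `Summit.ValiantsHypothesis.ValiantsHypothesis.…` repeats a component by the D-0017 layout
-- (single-conjunct summit), which the `dupNamespace` linter flags; the name is mandated.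
set_option linter.dupNamespace false

namespace Summit.ValiantsHypothesis.ValiantsHypothesis.Theorems.LacunarySymmetroidMatrixDescartes.Separated

open Polynomial Complex Set Finset
open scoped BigOperators Matrix Real

/-! ## §10 Relative form: «other letters ≤ ε × the live pair, |det| ≥ η σ^m, ε·C(m) < η» -/

section Relative

variable {K m : ℕ} (d : Fin K → ℕ) (S : Fin K → Matrix (Fin m) (Fin m) ℝ) (σ : Fin K → ℝ)

/-- Arithmetic of the relative form (window interior): if `E ≤ ε·T`, `M ≤ 2T`, `0 ≤ E`, `0 < T`, `0 ≤ ε ≤ 1` and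
`(m+1)^m·m!·m·3^m·ε < η`, then `(m+1)^m·m!·m·E·(M+E)^(m−1) < η·T^m`. [folklore] -/
theorem rel_arith_win {E M T ε η : ℝ} (hE0 : 0 ≤ E) (hE : E ≤ ε * T) (hM0 : 0 ≤ M) (hM : M ≤ 2 * T)
    (hT : 0 < T) (hε0 : 0 ≤ ε) (hε1 : ε ≤ 1)
    (hεη : ((m : ℝ) + 1) ^ m * (m.factorial : ℝ) * m * 3 ^ m * ε < η) :
    ((m : ℝ) + 1) ^ m * ((m.factorial : ℝ) * (m * E * (M + E) ^ (m - 1))) < η * T ^ m := by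
  have hME : M + E ≤ 3 * T := by nlinarith
  have hpow : (M + E) ^ (m - 1) ≤ (3 * T) ^ (m - 1) := pow_le_pow_left₀ (by linarith) hME _
  have h3 : (3 * T) ^ (m - 1) ≤ 3 ^ m * T ^ (m - 1) := by
    rw [mul_pow]
    refine mul_le_mul_of_nonneg_right (pow_le_pow_right₀ (by norm_num) (Nat.sub_le m 1)) (pow_nonneg hT.le _)
  have hA : ((m : ℝ) + 1) ^ m * ((m.factorial : ℝ) * (m * E * (M + E) ^ (m - 1))) ≤
      ((m : ℝ) + 1) ^ m * (m.factorial : ℝ) * m * 3 ^ m * ε * (T * T ^ (m - 1)) := by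
    have h1 : m * E * (M + E) ^ (m - 1) ≤ m * (ε * T) * (3 ^ m * T ^ (m - 1)) :=
      mul_le_mul (mul_le_mul_of_nonneg_left hE (Nat.cast_nonneg _)) (hpow.trans h3)
        (pow_nonneg (by linarith) _) (mul_nonneg (Nat.cast_nonneg _) (mul_nonneg hε0 hT.le))
    have h2 := mul_le_mul_of_nonneg_left (mul_le_mul_of_nonneg_left h1 (Nat.cast_nonneg m.factorial))
      (pow_nonneg (by positivity : (0 : ℝ) ≤ (m : ℝ) + 1) m)
    refine h2.trans (le_of_eq ?_)
    ring
  rcases Nat.eq_zero_or_pos m with hm | hm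
  · subst hm
    simp at hεη ⊢
    exact hεη
  · have hTm : T * T ^ (m - 1) = T ^ m := by
      rw [← pow_succ']; congr 1; omega
    rw [hTm] at hA
    have hTpos : 0 < T ^ m := pow_pos hT m
    calc ((m : ℝ) + 1) ^ m * ((m.factorial : ℝ) * (m * E * (M + E) ^ (m - 1)))
        ≤ ((m : ℝ) + 1) ^ m * (m.factorial : ℝ) * m * 3 ^ m * ε * T ^ m := hA
      _ < η * T ^ m := mul_lt_mul_of_pos_right hεη hTpos

/-- Arithmetic of the relative form (window end / dominance point): if `B ≤ ε·T`, `E ≤ ε·T`, `0 ≤ B, E`,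
`M ≤ 2T`, `0 < T`, `0 ≤ ε ≤ 1` and `(m+1)^m·m!·m·3^m·ε < η`, then `m!·m·(B + E)·(M + E)^(m−1) < η·T^m`. [folklore] -/
theorem rel_arith_end {B E M T ε η : ℝ} (hB : B ≤ ε * T) (hE0 : 0 ≤ E) (hE : E ≤ ε * T)
    (hM0 : 0 ≤ M) (hM : M ≤ 2 * T) (hT : 0 < T) (hε0 : 0 ≤ ε) (hε1 : ε ≤ 1)
    (hεη : ((m : ℝ) + 1) ^ m * (m.factorial : ℝ) * m * 3 ^ m * ε < η) :
    (m.factorial : ℝ) * (m * (B + E) * (M + E) ^ (m - 1)) < η * T ^ m := by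
  -- `m!·m·(B+E)·(M+E)^(m−1) ≤ (m+1)^m·m!·m·(2εT)(3T)^(m−1)/… `; we simply compare with the interior bound at `2E'`
  have hME : M + E ≤ 3 * T := by nlinarith
  have hpow : (M + E) ^ (m - 1) ≤ 3 ^ m * T ^ (m - 1) := by
    refine (pow_le_pow_left₀ (by linarith) hME _).trans ?_
    rw [mul_pow]
    exact mul_le_mul_of_nonneg_right (pow_le_pow_right₀ (by norm_num) (Nat.sub_le m 1)) (pow_nonneg hT.le _)
  have hA : (m.factorial : ℝ) * (m * (B + E) * (M + E) ^ (m - 1)) ≤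
      (m.factorial : ℝ) * m * 3 ^ m * (2 * ε) * (T * T ^ (m - 1)) := by
    have h1 : m * (B + E) * (M + E) ^ (m - 1) ≤ m * (2 * ε * T) * (3 ^ m * T ^ (m - 1)) :=
      mul_le_mul (mul_le_mul_of_nonneg_left (by linarith) (Nat.cast_nonneg _)) hpow
        (pow_nonneg (by linarith) _) (mul_nonneg (Nat.cast_nonneg _) (by positivity))
    refine (mul_le_mul_of_nonneg_left h1 (Nat.cast_nonneg _)).trans (le_of_eq ?_)
    ring
  rcases Nat.eq_zero_or_pos m with hm | hm
  · subst hm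
    simp at hεη ⊢
    exact hεη
  · have hTm : T * T ^ (m - 1) = T ^ m := by
      rw [← pow_succ']; congr 1; omega
    rw [hTm] at hA
    have hTpos : 0 < T ^ m := pow_pos hT m
    -- `2 ≤ (m+1)^m` for `m ≥ 1`
    have h2 : (2 : ℝ) ≤ ((m : ℝ) + 1) ^ m := by
      have : (2 : ℝ) ≤ (m : ℝ) + 1 := by
        have : (1 : ℝ) ≤ m := by exact_mod_cast hm
        linarith
      calc (2 : ℝ) = 2 ^ 1 := by norm_num
        _ ≤ ((m : ℝ) + 1) ^ 1 := by rw [pow_one, pow_one]; exact this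
        _ ≤ ((m : ℝ) + 1) ^ m := pow_le_pow_right₀ (by linarith) hm
    have hB' : (m.factorial : ℝ) * m * 3 ^ m * (2 * ε) ≤ ((m : ℝ) + 1) ^ m * (m.factorial : ℝ) * m * 3 ^ m * ε := by
      have hnn : 0 ≤ (m.factorial : ℝ) * m * 3 ^ m * ε := by positivity
      nlinarith
    calc (m.factorial : ℝ) * (m * (B + E) * (M + E) ^ (m - 1))
        ≤ (m.factorial : ℝ) * m * 3 ^ m * (2 * ε) * T ^ m := hA
      _ ≤ ((m : ℝ) + 1) ^ m * (m.factorial : ℝ) * m * 3 ^ m * ε * T ^ m := mul_le_mul_of_nonneg_right hB' hTpos.le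
      _ < η * T ^ m := mul_lt_mul_of_pos_right hεη hTpos

/-- **RELATIVE WINDOW LAW.**  `|S l i j| ≤ σ l`, `|det S a| ≥ η·σ a^m`, `|det S b| ≥ η·σ b^m` (conditioning `η`),
`σ a, σ b > 0`; on `0 < u < v` the other letters are `ε`-small against the live pair,
`E(x) ≤ ε·max(σ a x^(d a), σ b x^(d b))` for `x ∈ [u,v]`, and the pair has handed over across the window,
`σ b u^(d b) ≤ ε σ a u^(d a)`, `σ a v^(d a) ≤ ε σ b v^(d b)`; if `(m+1)^m·m!·m·3^m·ε < η` (and `ε ≤ 1`) then `det F`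
has at most `m` distinct real zeros in `(u, v)`. [folklore] -/
theorem card_realRoots_window_le_of_relSeparated (hσ : ∀ l i j, |S l i j| ≤ σ l) (hσ0 : ∀ l, 0 ≤ σ l)
    (a b : Fin K) (hab : d a < d b) (hσa : 0 < σ a) (hσb : 0 < σ b) {η ε : ℝ}
    (hdeta : η * σ a ^ m ≤ |(S a).det|) (hdetb : η * σ b ^ m ≤ |(S b).det|)
    (hε0 : 0 ≤ ε) (hε1 : ε ≤ 1) (hεη : ((m : ℝ) + 1) ^ m * (m.factorial : ℝ) * m * 3 ^ m * ε < η)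
    {u v : ℝ} (hu : 0 < u) (huv : u < v)
    (hleft : σ b * u ^ d b ≤ ε * (σ a * u ^ d a)) (hright : σ a * v ^ d a ≤ ε * (σ b * v ^ d b))
    (hwin : ∀ x ∈ Set.Icc u v, ∑ l ∈ (Finset.univ.erase a).erase b, σ l * x ^ d l ≤
      ε * max (σ a * x ^ d a) (σ b * x ^ d b)) :
    ((Matrix.det (∑ l, ((X : ℝ[X]) ^ d l) • (S l).map C)).roots.toFinset.filter
        (fun x => u < x ∧ x < v)).card ≤ m := by
  have hv : 0 < v := hu.trans huv
  have hEnn : ∀ x : ℝ, 0 ≤ x → 0 ≤ ∑ l ∈ (Finset.univ.erase a).erase b, σ l * x ^ d l :=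
    fun x hx => Finset.sum_nonneg fun l _ => mul_nonneg (hσ0 l) (pow_nonneg hx _)
  -- det lower bounds in the window currency
  have hdetpow : ∀ (l : Fin K) (x : ℝ), 0 ≤ x → η * σ l ^ m ≤ |(S l).det| →
      η * (σ l * x ^ d l) ^ m ≤ |(S l).det| * x ^ (m * d l) := by
    intro l x hx hdet
    rw [mul_pow, ← pow_mul, mul_comm (d l) m, ← mul_assoc]
    exact mul_le_mul_of_nonneg_right hdet (pow_nonneg hx _)
  refine card_realRoots_window_le_of_separated d S σ hσ hσ0 a b hab hu huv ?_ ?_ ?_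
  · -- left end: live letter `a`
    have hT : 0 < σ a * u ^ d a := mul_pos hσa (pow_pos hu _)
    have hEu := hwin u ⟨le_rfl, huv.le⟩
    have hmax : max (σ a * u ^ d a) (σ b * u ^ d b) = σ a * u ^ d a :=
      max_eq_left (hleft.trans (by nlinarith))
    rw [hmax] at hEu
    have hBT : σ b * u ^ d b ≤ σ a * u ^ d a := hleft.trans (mul_le_of_le_one_left hT.le hε1)
    have h := rel_arith_end (m := m) (M := σ a * u ^ d a + σ b * u ^ d b) hleft (hEnn u hu.le) hEu
      (add_nonneg hT.le (mul_nonneg (hσ0 b) (pow_nonneg hu.le _))) (by linarith) hT hε0 hε1 hεη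
    exact h.trans_le (hdetpow a u hu.le hdeta)
  · -- right end: live letter `b`
    have hT : 0 < σ b * v ^ d b := mul_pos hσb (pow_pos hv _)
    have hEv := hwin v ⟨huv.le, le_rfl⟩
    have hmax : max (σ a * v ^ d a) (σ b * v ^ d b) = σ b * v ^ d b :=
      max_eq_right (hright.trans (by nlinarith))
    rw [hmax] at hEv
    have hAT : σ a * v ^ d a ≤ σ b * v ^ d b := hright.trans (mul_le_of_le_one_left hT.le hε1)
    have h := rel_arith_end (m := m) (M := σ a * v ^ d a + σ b * v ^ d b) hright (hEnn v hv.le) hEv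
      (add_nonneg (mul_nonneg (hσ0 a) (pow_nonneg hv.le _)) hT.le) (by linarith) hT hε0 hε1 hεη
    exact h.trans_le (hdetpow b v hv.le hdetb)
  · -- interior
    intro x hx
    have hx0 : 0 < x := hu.trans_le hx.1
    have hTa : 0 < σ a * x ^ d a := mul_pos hσa (pow_pos hx0 _)
    have hTb : 0 < σ b * x ^ d b := mul_pos hσb (pow_pos hx0 _)
    have hT : 0 < max (σ a * x ^ d a) (σ b * x ^ d b) := lt_max_of_lt_left hTa
    have hM2 : σ a * x ^ d a + σ b * x ^ d b ≤ 2 * max (σ a * x ^ d a) (σ b * x ^ d b) := by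
      rw [two_mul]; exact add_le_add (le_max_left _ _) (le_max_right _ _)
    have h := rel_arith_win (m := m) (hEnn x hx0.le) (hwin x hx) (add_nonneg hTa.le hTb.le) hM2 hT hε0 hε1 hεη
    refine h.trans_le ?_
    -- `η T^m ≤ max (|det S a| x^(m d a)) (|det S b| x^(m d b))`
    rcases le_total (σ a * x ^ d a) (σ b * x ^ d b) with hab' | hab'
    · rw [max_eq_right hab']
      exact (hdetpow b x hx0.le hdetb).trans (le_max_right _ _)
    · rw [max_eq_left hab']
      exact (hdetpow a x hx0.le hdeta).trans (le_max_left _ _)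

/-- **RELATIVE DOMINANCE.**  If at `x > 0` the other letters are `ε`-small against the letter `a`,
`∑_{l ≠ a} σ l x^(d l) ≤ ε·σ a x^(d a)`, `|det S a| ≥ η σ a^m`, `σ a > 0` and `(m+1)^m·m!·m·3^m·ε < η`, `ε ≤ 1`,
then `det F(x) ≠ 0`. [folklore] -/
theorem not_isRoot_of_relDominance (hσ : ∀ l i j, |S l i j| ≤ σ l) (hσ0 : ∀ l, 0 ≤ σ l) (a : Fin K)
    (hσa : 0 < σ a) {η ε : ℝ} (hdeta : η * σ a ^ m ≤ |(S a).det|) (hε0 : 0 ≤ ε) (hε1 : ε ≤ 1)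
    (hεη : ((m : ℝ) + 1) ^ m * (m.factorial : ℝ) * m * 3 ^ m * ε < η) {x : ℝ} (hx : 0 < x)
    (hdom : ∑ l ∈ Finset.univ.erase a, σ l * x ^ d l ≤ ε * (σ a * x ^ d a)) :
    ¬ (Matrix.det (∑ l, ((X : ℝ[X]) ^ d l) • (S l).map C)).IsRoot x := by
  refine not_isRoot_of_letter_dominance d S σ hσ hσ0 a hx ?_
  have hT : 0 < σ a * x ^ d a := mul_pos hσa (pow_pos hx _)
  have hEnn : 0 ≤ ∑ l ∈ Finset.univ.erase a, σ l * x ^ d l :=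
    Finset.sum_nonneg fun l _ => mul_nonneg (hσ0 l) (pow_nonneg hx.le _)
  have h := rel_arith_end (m := m) (B := 0) (M := σ a * x ^ d a)
    (by positivity : (0 : ℝ) ≤ ε * (σ a * x ^ d a)) hEnn hdom hT.le (by linarith) hT hε0 hε1 hεη
  rw [zero_add] at h
  refine h.trans_le ?_
  rw [mul_pow, ← pow_mul, mul_comm (d a) m, ← mul_assoc]
  exact mul_le_mul_of_nonneg_right hdeta (pow_nonneg hx.le _)

/-- **RELATIVE LETTER-SEPARATED SECTOR.**  Letters with `|S l i j| ≤ σ l`, `0 < σ l`, conditioning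
`|det S l| ≥ η σ l^m`; `N` windows `(u j, v j)` with live pairs `a j, b j` (`d (a j) < d (b j)`) across which the
pair hands over (`σ_b u^(d b) ≤ ε σ_a u^(d a)`, `σ_a v^(d a) ≤ ε σ_b v^(d b)`) while the other letters stay
`ε`-small against the pair; outside the windows some single letter `ε`-dominates; and
`(m+1)^m·m!·m·3^m·ε < η`, `ε ≤ 1`.  Then `Z₊ ≤ N·m`. [folklore] -/
theorem card_posRoots_le_of_relSeparated (hσ : ∀ l i j, |S l i j| ≤ σ l) (hσpos : ∀ l, 0 < σ l)
    {η ε : ℝ} (hdet : ∀ l, η * σ l ^ m ≤ |(S l).det|) (hε0 : 0 ≤ ε) (hε1 : ε ≤ 1)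
    (hεη : ((m : ℝ) + 1) ^ m * (m.factorial : ℝ) * m * 3 ^ m * ε < η) {N : ℕ}
    (a b : Fin N → Fin K) (hab : ∀ j, d (a j) < d (b j)) (u v : Fin N → ℝ) (hu : ∀ j, 0 < u j)
    (huv : ∀ j, u j < v j)
    (hleft : ∀ j, σ (b j) * u j ^ d (b j) ≤ ε * (σ (a j) * u j ^ d (a j)))
    (hright : ∀ j, σ (a j) * v j ^ d (a j) ≤ ε * (σ (b j) * v j ^ d (b j)))
    (hwin : ∀ j, ∀ x ∈ Set.Icc (u j) (v j), ∑ l ∈ (Finset.univ.erase (a j)).erase (b j), σ l * x ^ d l ≤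
      ε * max (σ (a j) * x ^ d (a j)) (σ (b j) * x ^ d (b j)))
    (hcover : ∀ x : ℝ, 0 < x → (∃ j, u j < x ∧ x < v j) ∨
      ∃ l₀ : Fin K, ∑ l ∈ Finset.univ.erase l₀, σ l * x ^ d l ≤ ε * (σ l₀ * x ^ d l₀)) :
    ((Matrix.det (∑ l, ((X : ℝ[X]) ^ d l) • (S l).map C)).roots.toFinset.filter (fun t => 0 < t)).card
      ≤ N * m := by
  classical
  have hσ0 : ∀ l, 0 ≤ σ l := fun l => (hσpos l).le
  set f : ℝ[X] := Matrix.det (∑ l, ((X : ℝ[X]) ^ d l) • (S l).map C) with hf_def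
  by_cases hf0 : f = 0
  · rw [hf0, roots_zero, Multiset.toFinset_zero, Finset.filter_empty, Finset.card_empty]
    exact Nat.zero_le _
  have hsub : f.roots.toFinset.filter (fun t => 0 < t) ⊆
      (Finset.univ : Finset (Fin N)).biUnion
        (fun j => f.roots.toFinset.filter (fun x => u j < x ∧ x < v j)) := by
    intro x hx
    rw [Finset.mem_filter, Multiset.mem_toFinset, mem_roots hf0] at hx
    rcases hcover x hx.2 with ⟨j, hj⟩ | ⟨l₀, hl₀⟩
    · rw [Finset.mem_biUnion]
      refine ⟨j, Finset.mem_univ j, ?_⟩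
      rw [Finset.mem_filter, Multiset.mem_toFinset, mem_roots hf0]
      exact ⟨hx.1, hj⟩
    · exact absurd hx.1 (not_isRoot_of_relDominance d S σ hσ hσ0 l₀ (hσpos l₀) (hdet l₀) hε0 hε1 hεη hx.2 hl₀)
  calc (f.roots.toFinset.filter (fun t => 0 < t)).card
      ≤ ((Finset.univ : Finset (Fin N)).biUnion
          (fun j => f.roots.toFinset.filter (fun x => u j < x ∧ x < v j))).card := Finset.card_le_card hsub
    _ ≤ ∑ j : Fin N, (f.roots.toFinset.filter (fun x => u j < x ∧ x < v j)).card := Finset.card_biUnion_le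
    _ ≤ ∑ _j : Fin N, m :=
        Finset.sum_le_sum fun j _ => card_realRoots_window_le_of_relSeparated d S σ hσ hσ0 (a j) (b j) (hab j)
          (hσpos _) (hσpos _) (hdet _) (hdet _) hε0 hε1 hεη (hu j) (huv j) (hleft j) (hright j) (hwin j)
    _ = N * m := by rw [Finset.sum_const, Finset.card_univ, Fintype.card_fin, smul_eq_mul]

/-- All real zeros in the relative currency: the reflected pencil carries the same certificate, `Z ≤ 2Nm + 1`.
[folklore] -/
theorem card_realRoots_le_of_relSeparated (hσ : ∀ l i j, |S l i j| ≤ σ l) (hσpos : ∀ l, 0 < σ l)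
    {η ε : ℝ} (hdet : ∀ l, η * σ l ^ m ≤ |(S l).det|) (hε0 : 0 ≤ ε) (hε1 : ε ≤ 1)
    (hεη : ((m : ℝ) + 1) ^ m * (m.factorial : ℝ) * m * 3 ^ m * ε < η) {N : ℕ}
    (a b : Fin N → Fin K) (hab : ∀ j, d (a j) < d (b j)) (u v : Fin N → ℝ) (hu : ∀ j, 0 < u j)
    (huv : ∀ j, u j < v j)
    (hleft : ∀ j, σ (b j) * u j ^ d (b j) ≤ ε * (σ (a j) * u j ^ d (a j)))
    (hright : ∀ j, σ (a j) * v j ^ d (a j) ≤ ε * (σ (b j) * v j ^ d (b j)))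
    (hwin : ∀ j, ∀ x ∈ Set.Icc (u j) (v j), ∑ l ∈ (Finset.univ.erase (a j)).erase (b j), σ l * x ^ d l ≤
      ε * max (σ (a j) * x ^ d (a j)) (σ (b j) * x ^ d (b j)))
    (hcover : ∀ x : ℝ, 0 < x → (∃ j, u j < x ∧ x < v j) ∨
      ∃ l₀ : Fin K, ∑ l ∈ Finset.univ.erase l₀, σ l * x ^ d l ≤ ε * (σ l₀ * x ^ d l₀)) :
    (Matrix.det (∑ l, ((X : ℝ[X]) ^ d l) • (S l).map C)).roots.toFinset.card ≤ 2 * (N * m) + 1 := by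
  have hS' : ∀ l i j, |(((-1 : ℝ) ^ d l) • S l) i j| ≤ σ l := by
    intro l i j
    rw [Matrix.smul_apply, smul_eq_mul, abs_mul, abs_pow, abs_neg, abs_one, one_pow, one_mul]
    exact hσ l i j
  have hdet' : ∀ l, |(((-1 : ℝ) ^ d l) • S l).det| = |(S l).det| := by
    intro l
    rw [Matrix.det_smul, abs_mul, abs_pow, abs_pow, abs_neg, abs_one, one_pow, one_pow, one_mul]
  have h1 := card_posRoots_le_of_relSeparated d S σ hσ hσpos hdet hε0 hε1 hεη a b hab u v hu huv hleft hright
    hwin hcover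
  have h2 := card_posRoots_le_of_relSeparated d (fun l => ((-1 : ℝ) ^ d l) • S l) σ hS' hσpos
    (fun l => by rw [hdet']; exact hdet l) hε0 hε1 hεη a b hab u v hu huv hleft hright hwin hcover
  have h3 := stub_negRoots K m d S
  omega

/-- **The crux's inequality on the relative letter-separated sector, at all fat formats** (`N ≤ K` windows;
`Z ≤ 2Km + 1`, tree `Census.fatFormat_absorb`). Symmetry of the letters is not used. [folklore] -/
theorem relSeparatedSector_mdr (c q : ℕ) : ∃ K₀ : ℕ, ∀ K m : ℕ, K₀ ≤ K → m ≤ 2 ^ ((Nat.log 2 K + c) ^ c) →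
    ∀ (d : Fin K → ℕ) (S : Fin K → Matrix (Fin m) (Fin m) ℝ) (σ : Fin K → ℝ) (η ε : ℝ),
      (∀ l i j, |S l i j| ≤ σ l) → (∀ l, 0 < σ l) → (∀ l, η * σ l ^ m ≤ |(S l).det|) → 0 ≤ ε → ε ≤ 1 →
      ((m : ℝ) + 1) ^ m * (m.factorial : ℝ) * m * 3 ^ m * ε < η →
      ∀ (N : ℕ) (a b : Fin N → Fin K) (u v : Fin N → ℝ), N ≤ K → (∀ j, d (a j) < d (b j)) →
      (∀ j, 0 < u j) → (∀ j, u j < v j) →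
      (∀ j, σ (b j) * u j ^ d (b j) ≤ ε * (σ (a j) * u j ^ d (a j))) →
      (∀ j, σ (a j) * v j ^ d (a j) ≤ ε * (σ (b j) * v j ^ d (b j))) →
      (∀ j, ∀ x ∈ Set.Icc (u j) (v j), ∑ l ∈ (Finset.univ.erase (a j)).erase (b j), σ l * x ^ d l ≤
        ε * max (σ (a j) * x ^ d (a j)) (σ (b j) * x ^ d (b j))) →
      (∀ x : ℝ, 0 < x → (∃ j, u j < x ∧ x < v j) ∨
        ∃ l₀ : Fin K, ∑ l ∈ Finset.univ.erase l₀, σ l * x ^ d l ≤ ε * (σ l₀ * x ^ d l₀)) →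
      (Matrix.det (∑ l, ((X : ℝ[X]) ^ d l) • (S l).map C)).roots.toFinset.card ^ q ≤ 2 ^ (K * Nat.log 2 K) := by
  obtain ⟨K₀, hK₀⟩ := Census.fatFormat_absorb 2 c q
  refine ⟨K₀, fun K m hK hm d S σ η ε hσ hσpos hdet hε0 hε1 hεη N a b u v hN hab hu huv hleft hright hwin hcover =>
    hK₀ K m _ hK hm ?_⟩
  have h := card_realRoots_le_of_relSeparated d S σ hσ hσpos hdet hε0 hε1 hεη a b hab u v hu huv hleft hright
    hwin hcover
  have h2 : 2 * (N * m) + 1 ≤ 2 ^ 2 * (m + 1) * (K + 1) := by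
    have : N * m ≤ K * m := Nat.mul_le_mul_right m hN
    nlinarith
  exact h.trans h2

end Relative


end Summit.ValiantsHypothesis.ValiantsHypothesis.Theorems.LacunarySymmetroidMatrixDescartes.Separated
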